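import Summits.ResolutionOfSingularities.ResolutionOfSingularities.Theorems.MarkedTransferCampaignW46MohWindowSurfaceCore
import Summits.ResolutionOfSingularities.ResolutionOfSingularities.Theorems.MarkedTransferCampaignW46MohWindowSurfaceChart
import Summits.ResolutionOfSingularities.ResolutionOfSingularities.Theorems.MarkedTransferCampaignW46MohWindowSurfaceTransform
import Summits.ResolutionOfSingularities.ResolutionOfSingularities.Theorems.MarkedTransferCampaignW46MohWindowProof
import Literature.AlgebraicGeometry.Hironaka2017.Proofs.S16Proof.Lem16p11
import Literature.AlgebraicGeometry.Resolution.BlowupOffCentre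
import HarnessLib

/-!
# [OURS · L1 W4.6 rung (iii-2), piece (T)] Surface Moh window — ONE STEP of the typed Th. 16.6 procedure in the tame regime:
# the residual order DROPS at every singular point over the centre and is TRANSPORTED off it (cell res-hironaka,
# LADDER-RESOLUTION rung L, D-0089; unit res-L1-s46-pv-12 carried by res-D-pv-050; host MarkedTransfer,
# `--supports stmt-ResolutionOfSingularities-16155 --as helper`)

HONEST FRAMING. Nothing here is a statement of H. Hironaka's manuscript [Hironaka2017] and nothing here asserts that any statement
of it holds. THEOREMS about the OURS regime `CampaignW46.Regime.mohWindowSurfaceTame` (res-L1-type-o1, `…W46MohWindowSurface.lean`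
§5) over the shared typed-procedure module (`Step`, `IsCentre`): for a step `s` from a state `(A, E)` of the tame surface window
whose transform `(A′, E′)` is again in the regime —
* `MohWindowSurface.exponent_lt_of_chart` — ring level: in the Rees chart `i ∈ {0, 1}` at a singular point of the transform, every
  window presentation has exponent `<` the exponent downstairs (`…Chart.lean` + `core` of `…Core.lean`);
* `IsCentre.exists_eq_singleton_of_mohWindowSurfaceTame` — the admitted centre is ONE closed point `ξ ∈ Sing(E)`;
* `Step.residualOrder_lt_of_over_centre` — at every `ξ′ ∈ Sing(E′)` over `ξ` the residual order (o1's `residualOrder`, §6) is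
  `<` the one at `ξ` (the `z`-chart is impossible; residual orders are the exponents by res-D-pv-008's uniqueness);
* `Step.residualOrder_eq_of_not_over_centre` / `Step.base_mem_sing_diff_of_not_over_centre` — off `ξ` nothing changes.
AI-written; AI review is weaker than expert review. No `sorry`; axioms standard. [folklore]
-/

noncomputable section

set_option linter.dupNamespace false -- mandated namespace of this single-conjunct summit

open CategoryTheory AlgebraicGeometry TopologicalSpace IsLocalRing

namespace Summit.ResolutionOfSingularities.ResolutionOfSingularities.Theorems

namespace CampaignW46

open Literature.AlgebraicGeometry.Resolution
open Literature.AlgebraicGeometry.Hironaka2017.S02Preliminaries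
open Literature.AlgebraicGeometry.Hironaka2017.Datum
open Literature.AlgebraicGeometry.Hironaka2017.S16Proof
open Scheme.IdealSheafData
open Polynomial

universe u

/-! ## 1. Ring level: the exponent drops in the charts `i ∈ {0, 1}` -/

namespace MohWindowSurface

/-- **[OURS · L1 W4.6 rung (iii-2)] Ring-level step.** `R → L` (`ψ`) the stalk map at a point `ξ′` of the blow-up of a tame window
point, presented through the Rees chart `i ∈ {0,1}` (`L` a localisation of `R[𝔪/c_i]` at a prime `𝔴` over `𝔪_R`, `ψ = χ ∘ (c ↦ c/1)`):
if the transform ideal `I′ = ((ψ g) : (ψ c_i)^p)` of the window equation `g = c₂^p + Σ a_k c_i^{d−u_k} c_{i'}^{u_k}` (tame residue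
polynomial `Σ ā_k X^{u_k}`) lies in `𝔪_L^p` (the point is singular) and has a window presentation `I′ = (z₁^p + Σ a′_k x₁^{d′−k} y₁^k)`
with `p < d′`, and `𝔪_L` needs three generators, then `d′ < d`. NOT a statement of the manuscript. [folklore] -/
theorem exponent_lt_of_chart {R : Type u} [CommRing R] [IsRegularLocalRing R] (p : ℕ) [Fact p.Prime]
    (h3 : (maximalIdeal R).spanFinrank = 3) (c : Fin 3 → R) (hc : Ideal.span (Set.range c) = maximalIdeal R)
    {i i' : Fin 3} (hi : i ≠ 2) (hi' : i' ≠ 2) (hii' : i ≠ i') {d : ℕ} (hpd : p < d) (hd2 : d < 2 * p) (a : ℕ → R)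
    (u : ℕ → ℕ) (hu : ∀ k, u k ≤ d)
    (htame : ∀ τ : ResidueField R, ¬ (X - C τ) ^ p ∣ ∑ k ∈ Finset.range (d + 1), C (residue R (a k)) * X ^ (u k))
    (𝔴 : Ideal (chartRing c i)) [𝔴.IsPrime] (h𝔴 : 𝔴.comap (chartBase c i) = maximalIdeal R)
    (L : Type u) [CommRing L] [IsLocalRing L] [Algebra (chartRing c i) L] [IsLocalization.AtPrime L 𝔴] [CharP L p]
    (h3L : (maximalIdeal L).spanFinrank = 3) (ψ : R →+* L)
    (hψ : ∀ r, ψ r = (algebraMap (chartRing c i) L : chartRing c i →+* L) (chartBase c i r))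
    {I' : Ideal L}
    (hI' : I' = Submodule.colon (Ideal.span {ψ (c 2 ^ p + ∑ k ∈ Finset.range (d + 1), a k * c i ^ (d - u k) * c i' ^ (u k))})
      ((Ideal.span {ψ (c i)} ^ p : Ideal L) : Set L))
    (hsing : I' ≤ maximalIdeal L ^ p) {x₁ y₁ z₁ : L} (hxyz₁ : Ideal.span {x₁, y₁, z₁} = maximalIdeal L) {d₁ : ℕ}
    (hpd₁ : p < d₁) (a₁ : ℕ → L)
    (hI₁ : I' = Ideal.span {z₁ ^ p + ∑ k ∈ Finset.range (d₁ + 1), a₁ k * x₁ ^ (d₁ - k) * y₁ ^ k}) : d₁ < d := by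
  classical
  have hp1 : 1 ≤ p := (Fact.out : p.Prime).one_lt.le
  set alg : chartRing c i →+* L := (algebraMap (chartRing c i) L : chartRing c i →+* L) with halg
  -- `L` is regular, `ψ (c i)` is a non-zero regular parameter
  have hz0 : Ideal.span (Set.range (Fin.append c (fun k : Fin 0 => Fin.elim0 k : Fin 0 → R))) = maximalIdeal R := by
    rw [span_range_append_elim0]; exact hc
  have hd0 : (maximalIdeal R).spanFinrank = 3 + 0 := by rw [h3]
  have hrsop := isRsopPart_chartFamily_reesChart c i (fun k : Fin 0 => Fin.elim0 k) hz0 hd0 𝔴 h𝔴 L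
    (a := 0) (fun k : Fin 0 => Fin.elim0 k) (Function.injective_of_subsingleton _) (fun k => Fin.elim0 k)
  haveI hLreg : IsRegularLocalRing L := hrsop.isRegularLocalRing
  haveI : IsDomain L := isDomain_of_isRegularLocalRing L
  have hci : ψ (c i) ∈ maximalIdeal L := by
    have h0 := hrsop.mem_maximalIdeal 0
    rw [hψ]; simpa only [chartFamily, Fin.cons_zero] using h0
  have hci0 : ψ (c i) ≠ 0 := by
    have h0 := hrsop.ne_zero 0
    rw [hψ]; simpa only [chartFamily, Fin.cons_zero] using h0
  -- chart relations and the factorisation of the pulled-back equation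
  have hrel : ∀ l, ψ (c l) = ψ (c i) * alg (chartGen c i l) := fun l => by
    rw [hψ, hψ, halg, ← map_mul, ← reesChartBase_apply_eq_mul_chartGen c i l]
  set f : L := ∑ k ∈ Finset.range (d + 1), alg (chartBase c i (a k)) * alg (chartGen c i i') ^ (u k) with hf
  have hfψ : ∑ k ∈ Finset.range (d + 1), ψ (a k) * alg (chartGen c i i') ^ (u k) = f := by
    rw [hf]; refine Finset.sum_congr rfl fun k _ => ?_; rw [hψ]
  have hfac := map_window_eq_chart ψ (hrel i') (hrel 2) hpd.le a u hu
  rw [hfψ] at hfac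
  -- the transform ideal is principal, generated by `g₁ = e₂^p + ψ(c_i)^{d-p} f`
  set g₁ : L := alg (chartGen c i 2) ^ p + ψ (c i) ^ (d - p) * f with hg₁
  have hI'eq : I' = Ideal.span {g₁} := by
    rw [hI', hfac, colon_span_pow_mul (mem_nonZeroDivisors_of_ne_zero hci0)]
  -- `e₂ ∈ 𝔪_L` since `g₁ ∈ I′ ⊆ 𝔪^p ⊆ 𝔪`
  have hg₁m : g₁ ∈ maximalIdeal L := by
    have : g₁ ∈ I' := by rw [hI'eq]; exact Ideal.mem_span_singleton_self _
    exact Ideal.pow_le_self (by omega) (hsing this)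
  have hz : alg (chartGen c i 2) ∈ maximalIdeal L := by
    have h1 : ψ (c i) ^ (d - p) * f ∈ maximalIdeal L :=
      Ideal.mul_mem_right _ _ (Ideal.pow_mem_of_mem _ hci _ (Nat.sub_pos_of_lt hpd))
    have h2 : alg (chartGen c i 2) ^ p ∈ maximalIdeal L := by
      have := Ideal.sub_mem _ hg₁m h1
      rwa [hg₁, add_sub_cancel_right] at this
    exact Ideal.IsPrime.mem_of_pow_mem inferInstance p h2
  -- the data of `core`
  obtain ⟨-, ρ, G, μ, hμp, hGu, hgen, hfρ⟩ := exists_core_data p h3 c hc hi hi' hii' hd2 a u hu htame 𝔴 h𝔴 L h3L hz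
  rw [← hψ] at hgen hfρ
  rw [← hf] at hfρ
  -- the upstairs presentation in the shape of `core`
  have hz₁ : z₁ ∈ maximalIdeal L :=
    hxyz₁ ▸ Ideal.subset_span (Set.mem_insert_of_mem _ (Set.mem_insert_of_mem _ (Set.mem_singleton _)))
  have hf₁ : ∑ k ∈ Finset.range (d₁ + 1), a₁ k * x₁ ^ (d₁ - k) * y₁ ^ k ∈ maximalIdeal L ^ d₁ := by
    have hle : Ideal.span {x₁, y₁} ≤ maximalIdeal L := by
      rw [← hxyz₁]
      refine Ideal.span_mono ?_
      intro b hb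
      rcases hb with rfl | rfl
      · exact Set.mem_insert _ _
      · exact Set.mem_insert_of_mem _ (Set.mem_insert _ _)
    exact Ideal.pow_right_mono hle d₁ (coeffForm_mem_span_pow x₁ y₁ d₁ a₁)
  obtain ⟨m, hm⟩ : ∃ m, d = p + m := ⟨d - p, (Nat.add_sub_cancel' hpd.le).symm⟩
  have hm1 : 1 ≤ m := by omega
  have hmp : m < p := by omega
  have hdm : d - p = m := by omega
  rw [hdm] at hg₁
  have heq : Ideal.span {alg (chartGen c i 2) ^ p + ψ (c i) ^ m * f} =
      Ideal.span {z₁ ^ p + ∑ k ∈ Finset.range (d₁ + 1), a₁ k * x₁ ^ (d₁ - k) * y₁ ^ k} := by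
    rw [← hg₁, ← hI'eq, hI₁]
  have := core p h3L hgen hm1 hmp hμp hGu hfρ hz₁ hf₁ hpd₁ heq
  omega

end MohWindowSurface

/-! ## 2. Scheme level: one step of the typed procedure in the tame regime -/

section Proof

variable {n : ℕ} {p : ℕ} [Fact p.Prime] {K : Type u} [Field K] [CharP K p]
variable {N : Notions.{u} n} {A A' : AmbientDatum p K} {E : IdealExponent A.Z} {R : Resume N A E}

/-- In the tame surface regime an admitted centre is a single closed point of `Sing(E)` (closed irreducible inside a finite set
of closed points). [folklore] -/
theorem IsCentre.exists_eq_singleton_of_mohWindowSurfaceTame {D : Closeds A.Z} (hD : IsCentre R D)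
    (hRg : Regime.mohWindowSurfaceTame A E) :
    ∃ ξ : A.Z, ξ ∈ E.sing ∧ IsClosed ({ξ} : Set A.Z) ∧ (D : Set A.Z) = {ξ} := by
  obtain ⟨-, -, hcl, -⟩ := hRg
  have hirr := hD.irreducible
  have hgen : IsGenericPoint hirr.genericPoint (D : Set A.Z) := hirr.isGenericPoint_genericPoint D.isClosed
  have hηS : hirr.genericPoint ∈ E.sing := hD.subset_sing hgen.mem
  have hηcl : IsClosed ({hirr.genericPoint} : Set A.Z) := hcl hηS
  exact ⟨hirr.genericPoint, hηS, hηcl, hgen.def.symm.trans hηcl.closure_eq⟩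

/-- The window form written in the letters of the chart `i = 0` (free exponent `min k d = k` on the range):
`Σ a_k x^{d−k} y^k = Σ a_k x^{d − min k d} y^{min k d}`. [folklore] -/
theorem window_sum_chart_zero {S : Type u} [CommRing S] (x y : S) (d : ℕ) (a : ℕ → S) :
    ∑ k ∈ Finset.range (d + 1), a k * x ^ (d - k) * y ^ k =
      ∑ k ∈ Finset.range (d + 1), a k * x ^ (d - min k d) * y ^ (min k d) := by
  refine Finset.sum_congr rfl fun k hk => ?_
  rw [min_eq_left (Nat.lt_succ_iff.mp (Finset.mem_range.mp hk))]

/-- The residue polynomial of the chart `i = 0` with the truncated exponent `min k d`. [folklore] -/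
theorem residue_sum_chart_zero {κ : Type u} [CommRing κ] (d : ℕ) (b : ℕ → κ) :
    ∑ k ∈ Finset.range (d + 1), Polynomial.C (b k) * Polynomial.X ^ k =
      ∑ k ∈ Finset.range (d + 1), Polynomial.C (b k) * Polynomial.X ^ (min k d) := by
  refine Finset.sum_congr rfl fun k hk => ?_
  rw [min_eq_left (Nat.lt_succ_iff.mp (Finset.mem_range.mp hk))]

/-- The window form written in the letters of the chart `i = 1`: `Σ a_k x^{d−k} y^k = Σ a_k c₁^{d − (d − k)} c₀^{d − k}`. [folklore] -/
theorem window_sum_chart_one {S : Type u} [CommRing S] (x y : S) (d : ℕ) (a : ℕ → S) :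
    ∑ k ∈ Finset.range (d + 1), a k * x ^ (d - k) * y ^ k =
      ∑ k ∈ Finset.range (d + 1), a k * y ^ (d - (d - k)) * x ^ (d - k) := by
  refine Finset.sum_congr rfl fun k hk => ?_
  have hkd : k ≤ d := Nat.lt_succ_iff.mp (Finset.mem_range.mp hk)
  rw [Nat.sub_sub_self hkd]
  ring

/-- **[OURS · L1 W4.6 rung (iii-2)] THE DROP OVER THE CENTRE.** For a step `s` of the typed procedure from a state in the tame
surface window with transform again in the tame surface window, at every singular point `ξ′` of `E′` lying over the centre the
residual order of `J′_{ξ′}` is strictly smaller than that of `J_{π ξ′}`. NOT a statement of the manuscript. [folklore] -/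
theorem Step.residualOrder_lt_of_over_centre (s : Step R A') (hRg : Regime.mohWindowSurfaceTame A E)
    (hRg' : Regime.mohWindowSurfaceTame A' s.E') {x' : A'.Z} (hx' : x' ∈ s.E'.sing)
    (hover : s.π.base x' ∈ (s.D : Set A.Z)) :
    (residualOrder s.E'.b (A'.Z.presheaf.stalk x') (stalkIdeal s.E'.J x')).toNat <
      (residualOrder E.b (A.Z.presheaf.stalk (s.π.base x')) (stalkIdeal E.J (s.π.base x'))).toNat := by
  classical
  obtain ⟨ξ, hξS, hξcl, hDξ⟩ := s.centre.exists_eq_singleton_of_mohWindowSurfaceTame hRg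
  have hπx : s.π.base x' = ξ := by simpa [hDξ] using hover
  obtain ⟨hb, -, -, hwin⟩ := hRg
  obtain ⟨-, -, -, hwin'⟩ := hRg'
  have hbE' : s.E'.b = E.b := rfl
  haveI : IsLocallyNoetherian A'.Z := by
    haveI := A'.smooth
    exact LocallyOfFiniteType.isLocallyNoetherian A'.hom
  have hπ : IsBlowup s.π (vanishingIdeal s.D) := s.blowup
  have hp1 : 1 ≤ p := (Fact.out : p.Prime).one_lt.le
  -- the tame presentation downstairs, at `π x' = ξ`
  obtain ⟨hRreg, h3, x, y, z, hxyz, d, a, hbd, hd2, hunit, hJ, htx, hty⟩ := hwin _ (hπx ▸ hξS)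
  rw [hb] at hbd hd2 hJ htx hty
  haveI := hRreg
  -- the tame presentation upstairs, at `x'`
  obtain ⟨hLreg, h3L, x₁, y₁, z₁, hxyz₁, d₁, a₁, hbd₁, hd2₁, hunit₁, hJ₁, -, -⟩ := hwin' _ hx'
  rw [hbE', hb] at hbd₁ hd2₁ hJ₁
  haveI := hLreg
  haveI : CharP (A.Z.presheaf.stalk (s.π.base x')) p := Lem16p11Proof.charP_stalk A (𝟙 A.Z) _
  haveI : CharP (A'.Z.presheaf.stalk x') p := Lem16p11Proof.charP_stalk A s.π x'
  -- both residual orders are the exponents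
  rw [hbE', hb, hJ, hJ₁, MohWindowSurface.residualOrder_coeff p hLreg h3L hxyz₁ hbd₁ hd2₁ hunit₁,
    MohWindowSurface.residualOrder_coeff p hRreg h3 hxyz hbd hd2 hunit, ENat.toNat_coe, ENat.toNat_coe]
  -- the Rees chart at `x'`
  set c : Fin 3 → A.Z.presheaf.stalk (s.π.base x') := ![x, y, z] with hc_def
  have hc : Ideal.span (Set.range c) = maximalIdeal _ := by rw [hc_def, MohWindowSurface.range_vec3]; exact hxyz
  have hY : stalkIdeal (vanishingIdeal s.D) (s.π.base x') = maximalIdeal (A.Z.presheaf.stalk (s.π.base x')) := by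
    apply stalkIdeal_vanishingIdeal_eq_maximalIdeal_of_closure_eq
    rw [hDξ, hπx, hξcl.closure_eq]
  have hcY : Ideal.span (Set.range c) = stalkIdeal (vanishingIdeal s.D) (s.π.base x') := hc.trans hY.symm
  obtain ⟨j, 𝔴, χ, hχ, hloc, h𝔴⟩ := hπ.exists_reesChart_stalk x' c hcY
  letI := χ.toAlgebra
  haveI : IsLocalization.AtPrime (A'.Z.presheaf.stalk x') 𝔴.asIdeal := hloc
  set ψ : A.Z.presheaf.stalk (s.π.base x') →+* A'.Z.presheaf.stalk x' := (s.π.stalkMap x').hom with hψ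
  have hψa : ∀ r, ψ r = (algebraMap (chartRing c j) (A'.Z.presheaf.stalk x') :
      chartRing c j →+* A'.Z.presheaf.stalk x') (chartBase c j r) := fun r => (hχ r).symm
  have hrel : ∀ l, ψ (c l) = ψ (c j) * χ (chartGen c j l) := stalkMap_apply_eq_mul_chartGen j χ hχ
  -- the stalk of the transform is the colon `((ψ g) : (ψ c_j)^p)`
  have hCmap : (stalkIdeal (vanishingIdeal s.D) (s.π.base x')).map ψ = Ideal.span {ψ (c j)} := by
    rw [← hcY, Ideal.map_span_range_eq_span_singleton _ c j _ hrel]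
  have hstalk : stalkIdeal s.E'.J x' =
      Submodule.colon (Ideal.span {ψ (z ^ p + ∑ k ∈ Finset.range (d + 1), a k * x ^ (d - k) * y ^ k)})
        ((Ideal.span {ψ (c j)} ^ p : Ideal _) : Set _) := by
    show stalkIdeal (controlledTransform s.π (vanishingIdeal s.D) E.J E.b) x' = _
    rw [controlledTransform, stalkIdeal_colon, stalkIdeal_pow, stalkIdeal_comap_eq_map_stalkMap,
      stalkIdeal_comap_eq_map_stalkMap, ← hψ, hCmap, hJ, Ideal.map_span, Set.image_singleton, hb]
  have hx'sing : stalkIdeal s.E'.J x' ≤ maximalIdeal _ ^ p := by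
    have := (le_idealOrder_iff s.E'.J x' s.E'.b).mp hx'
    rwa [hbE', hb] at this
  have hcj : ψ (c j) ∈ maximalIdeal _ := by
    rw [hψa]
    exact (IsLocalization.AtPrime.to_map_mem_maximal_iff _ 𝔴.asIdeal _).mpr
      (by rw [← Ideal.mem_comap, h𝔴, ← hc]; exact Ideal.subset_span ⟨j, rfl⟩)
  haveI : IsDomain (A'.Z.presheaf.stalk x') := isDomain_of_isRegularLocalRing _
  -- which chart?
  obtain rfl | rfl | rfl : j = 0 ∨ j = 1 ∨ j = 2 := by
    rcases j with ⟨j, hj⟩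
    have : j = 0 ∨ j = 1 ∨ j = 2 := by omega
    rcases this with rfl | rfl | rfl
    · exact Or.inl rfl
    · exact Or.inr (Or.inl rfl)
    · exact Or.inr (Or.inr rfl)
  · -- chart `x`: free letter `y`, `u k = min k d`, tameness `tame_x`
    have htx' : ∀ τ : ResidueField (A.Z.presheaf.stalk (s.π.base x')), ¬ (X - C τ) ^ p ∣
        ∑ k ∈ Finset.range (d + 1), C (residue _ (a k)) * X ^ (min k d) := by
      intro τ; rw [← residue_sum_chart_zero]; exact htx τ
    refine MohWindowSurface.exponent_lt_of_chart p h3 c hc (i := 0) (i' := 1) (by decide) (by decide) (by decide) hbd hd2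
      a (fun k => min k d) (fun k => min_le_right k d) htx' 𝔴.asIdeal h𝔴 _ h3L ψ hψa (I' := stalkIdeal s.E'.J x') ?_
      hx'sing hxyz₁ hbd₁ a₁ hJ₁
    rw [hstalk, window_sum_chart_zero]
    rfl
  · -- chart `y`: free letter `x`, `u k = d - k`, tameness `tame_y`
    refine MohWindowSurface.exponent_lt_of_chart p h3 c hc (i := 1) (i' := 0) (by decide) (by decide) (by decide) hbd hd2
      a (fun k => d - k) (fun k => Nat.sub_le d k) hty 𝔴.asIdeal h𝔴 _ h3L ψ hψa (I' := stalkIdeal s.E'.J x') ?_ hx'sing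
      hxyz₁ hbd₁ a₁ hJ₁
    rw [hstalk, window_sum_chart_one]
    rfl
  · -- chart `z`: the cofactor is a unit, the transform is the unit ideal — `x'` would not be singular
    exfalso
    have hfac := MohWindowSurface.map_window_eq_chart_two ψ (hrel 0) (hrel 1) hbd.le a (d := d)
    have hunit2 := MohWindowSurface.isUnit_chart_two_cofactor hcj hbd
      (S := ∑ k ∈ Finset.range (d + 1), ψ (a k) * χ (chartGen c 2 0) ^ (d - k) * χ (chartGen c 2 1) ^ k)
    have hne : ψ (c 2) ≠ 0 := by
      have hz0 : Ideal.span (Set.range (Fin.append c (fun k : Fin 0 => Fin.elim0 k : Fin 0 → _))) = maximalIdeal _ := by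
        rw [MohWindowSurface.span_range_append_elim0]; exact hc
      have hd0 : (maximalIdeal (A.Z.presheaf.stalk (s.π.base x'))).spanFinrank = 3 + 0 := by rw [h3]
      have hrsop := isRsopPart_chartFamily_reesChart c 2 (fun k : Fin 0 => Fin.elim0 k) hz0 hd0 𝔴.asIdeal h𝔴
        (A'.Z.presheaf.stalk x') (a := 0) (fun k : Fin 0 => Fin.elim0 k) (Function.injective_of_subsingleton _)
        (fun k => Fin.elim0 k)
      have h0 := hrsop.ne_zero 0
      rw [hψa]; simpa only [chartFamily, Fin.cons_zero] using h0
    have htop : stalkIdeal s.E'.J x' = ⊤ := by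
      rw [hstalk]
      have : ψ (z ^ p + ∑ k ∈ Finset.range (d + 1), a k * x ^ (d - k) * y ^ k) =
          ψ (c 2) ^ p * (1 + ψ (c 2) ^ (d - p) *
            ∑ k ∈ Finset.range (d + 1), ψ (a k) * χ (chartGen c 2 0) ^ (d - k) * χ (chartGen c 2 1) ^ k) := hfac
      rw [this, MohWindowSurface.colon_span_pow_mul (mem_nonZeroDivisors_of_ne_zero hne), Ideal.span_singleton_eq_top]
      exact hunit2
    have h1 : (1 : A'.Z.presheaf.stalk x') ∈ maximalIdeal _ := by
      have := hx'sing (htop ▸ Submodule.mem_top : (1 : A'.Z.presheaf.stalk x') ∈ stalkIdeal s.E'.J x')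
      exact Ideal.pow_le_self (by omega) this
    exact (maximalIdeal.isMaximal _).ne_top ((Ideal.eq_top_iff_one _).mpr h1)

/-- **Off the centre the residual order is transported**: for `ξ′ ∈ Z′` not over the centre, `π` is an isomorphism on stalks and
`J′_{ξ′} = J_{π ξ′} 𝒪_{ξ′}`, so the residual orders agree. [folklore] -/
theorem Step.residualOrder_eq_of_not_over_centre (s : Step R A') {x' : A'.Z} (hover : s.π.base x' ∉ (s.D : Set A.Z)) :
    residualOrder s.E'.b (A'.Z.presheaf.stalk x') (stalkIdeal s.E'.J x') =
      residualOrder E.b (A.Z.presheaf.stalk (s.π.base x')) (stalkIdeal E.J (s.π.base x')) := by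
  haveI : IsLocallyNoetherian A'.Z := by
    haveI := A'.smooth
    exact LocallyOfFiniteType.isLocallyNoetherian A'.hom
  have hπ : IsBlowup s.π (vanishingIdeal s.D) := s.blowup
  have hnot : s.π.base x' ∉ (vanishingIdeal s.D).support := by
    rw [← SetLike.mem_coe, coe_support_vanishingIdeal]; exact hover
  have h1 : stalkIdeal s.E'.J x' = (stalkIdeal E.J (s.π.base x')).map (s.π.stalkMap x').hom := by
    show stalkIdeal (controlledTransform s.π (vanishingIdeal s.D) E.J E.b) x' = _
    rw [hπ.stalkIdeal_controlledTransform_of_not_mem E.J E.b hnot, stalkIdeal_comap_eq_map_stalkMap]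
  haveI := hπ.isIso_stalkMap_of_not_mem_support hnot
  let e : A.Z.presheaf.stalk (s.π.base x') ≃+* A'.Z.presheaf.stalk x' := (asIso (s.π.stalkMap x')).commRingCatIsoToRingEquiv
  have he : ((e : A.Z.presheaf.stalk (s.π.base x') →+* A'.Z.presheaf.stalk x') : _ → _) = (s.π.stalkMap x').hom := rfl
  have h2 : (stalkIdeal E.J (s.π.base x')).map (s.π.stalkMap x').hom =
      (stalkIdeal E.J (s.π.base x')).map (e : A.Z.presheaf.stalk (s.π.base x') →+* A'.Z.presheaf.stalk x') := by
    unfold Ideal.map; rw [he]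
  rw [h1, h2, show s.E'.b = E.b from rfl, MohWindowSurface.residualOrder_map_ringEquiv]

/-- Off the centre a singular point of `E′` lies over a singular point of `E` other than the centre point. [folklore] -/
theorem Step.base_mem_sing_of_not_over_centre (s : Step R A') {x' : A'.Z} (hx' : x' ∈ s.E'.sing)
    (hover : s.π.base x' ∉ (s.D : Set A.Z)) : s.π.base x' ∈ E.sing := by
  haveI : IsLocallyNoetherian A'.Z := by
    haveI := A'.smooth
    exact LocallyOfFiniteType.isLocallyNoetherian A'.hom
  have hπ : IsBlowup s.π (vanishingIdeal s.D) := s.blowup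
  have hnot : s.π.base x' ∉ (vanishingIdeal s.D).support := by
    rw [← SetLike.mem_coe, coe_support_vanishingIdeal]; exact hover
  have hx'b : (E.b : ℕ∞) ≤ idealOrder (controlledTransform s.π (vanishingIdeal s.D) E.J E.b) x' := hx'
  show (E.b : ℕ∞) ≤ idealOrder E.J (s.π.base x')
  rw [← hπ.idealOrder_controlledTransform_of_not_mem E.J E.b hnot]
  exact hx'b

end Proof

end CampaignW46

end Summit.ResolutionOfSingularities.ResolutionOfSingularities.Theorems

end
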